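import Mathlib
import Summits.ResolutionOfSingularities.ResolutionOfSingularities.Theorems.HomologicalConductorPersistenceCyclicTransferAbelianBicharacter
import Summits.ResolutionOfSingularities.ResolutionOfSingularities.Theorems.HomologicalConductorPersistenceCyclicTransferAbelianCeiling
import Literature.RingTheory.CohomologyAnnihilator.RegularRing
import HarnessLib

/-!
# Rung S-2 `PersistenceSurface` (stmt-19970) — the CYCLIC QUOTIENT SURFACE `k[u,v]^{μ_n(1,q)}`: the transfer package
# instantiated, every abstract hypothesis discharged (chain W4.4b, seat res-L1-w44b-stub-4 gen 5; T-V part 13)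

[OURS · L1 w44b · rung S-2] Nothing here is a statement of the manuscript under review (Hironaka 2017);
AI-written, weaker than expert review.

WHY. Every step-2/step-3 decision of the S-2 ledger ends at CYCLIC QUOTIENT arrivals `P = 1/n(1,q)` where the
engines test «image of the centre ∈ ca(P)» by the monomial criterion «`m ∈ ⋂_a τ(M_a)`, i.e. for every residue `a`
mod `n` the monomial `m` has a divisor of weight `a`» (tri-2 `kstar.cyclic_ca_contains`, plan-1 `cycca.py`, tri-1
`casetable`, idea-1 `sb/qca.py`).  Parts 11–12 prove `𝔞₁·1 ⊆ ca³(V^G) ⊆ 𝔞₁` abstractly; this file instantiates them at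
`V = k[u,v]`, `G = μ_n` acting by `u ↦ ζu`, `v ↦ ζ^q v` (`ζ` a primitive `n`-th root of unity, `n ∈ kˣ`,
`gcd(q,n) = 1`), discharging the fixed-ring, character, orthogonality, (BIG), normality and `ca³(V) = V` hypotheses in
the kernel.  What remains as instance hypotheses: `U` noetherian and `k[u,v]` module-finite over `U` (E. Noether's
finiteness of invariants; standard, not re-proved here).

RESULTS (`U ⊆ k[u,v]` any subalgebra with `p ∈ U ↔ σ₀ p = p`, `σ₀ = (u ↦ ζu, v ↦ ζ^q v)`).
* `rootAut`, `rootAut_X`, `rootAut_monomial`, `rootAut_pow_card` — the grading automorphism and `σ₀ⁿ = 1`.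
* `exists_action` — the data of parts 8–12: `σ : Multiplicative (ZMod n) →* (V →ₐ[U] V)` with fixed ring `U`
  and `σ (ofAdd a) = σ₀^{a.val}`.
* `hbig_cyclicQuotient` — (BIG): for every residue `t` and every height-one prime `P ⊂ k[u,v]` one of
  `u^t`, `v^s` (`qs ≡ t`) has character `t` and avoids `P` (`(u,v)` has height 2: `⊥ < (u) < P` is impossible).
* **`mem_cohomologyAnnihilatorOfDegree_three_iff_cyclicQuotient`** — AUSLANDER'S LAW for `1/n(1,q)`:
  `x ∈ ca³(U) ⟺ ∀ a, x = Σ_k b_k b′_k` with `b_k` of weight `a`, `b′_k` of weight `−a`.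
* **`monomial_mem_cohomologyAnnihilatorOfDegree_three`** — the engines' criterion: an invariant monomial
  `uⁱvʲ` whose divisors realise every residue mod `n` lies in `ca³(U) ⊆ ca(U)`.

References: Iyengar–Takahashi, IMRN 2016, arXiv:1404.1476 [`IyengarTakahashi2014`]; M. Auslander, *Rational
singularities and almost split sequences*, Trans. AMS 293 (1986); folklore.
-/

-- single-problem summit: the doubled namespace component `ResolutionOfSingularities` is forced
set_option linter.dupNamespace false

noncomputable section

open CategoryTheory Literature.RingTheory.CohomologyAnnihilator MvPolynomial
open Summit.ResolutionOfSingularities.ResolutionOfSingularities.Theorems.HomologicalConductor.PersistenceCyclicTransferFamily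
open Summit.ResolutionOfSingularities.ResolutionOfSingularities.Theorems.HomologicalConductor.PersistenceCyclicTransferAbelianBicharacter
open Summit.ResolutionOfSingularities.ResolutionOfSingularities.Theorems.HomologicalConductor.PersistenceCyclicTransferAbelianCeiling

universe u

namespace Summit.ResolutionOfSingularities.ResolutionOfSingularities.Theorems.HomologicalConductor.PersistenceCyclicQuotientSurface

variable {k : Type u} [Field k]

/-! ## The grading automorphism `σ₀ : u ↦ ζ u, v ↦ ζ^q v` -/

/-- The exponent used on the `i`-th variable: `1` on `u = X 0`, `q` on `v = X 1`. [OURS · L1 w44b] -/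
theorem weight_apply (q : ℕ) (i : Fin 2) : (![1, q] : Fin 2 → ℕ) i = if i = 0 then 1 else q := by
  fin_cases i <;> simp

/-- `σ₀(X i) = ζ^{w i} X i`. [folklore] -/
theorem rootAut_X (ζ : k) (q : ℕ) (i : Fin 2) :
    aeval (fun i : Fin 2 => C (ζ ^ (![1, q] : Fin 2 → ℕ) i) * X i) (X i : MvPolynomial (Fin 2) k) =
      C (ζ ^ (![1, q] : Fin 2 → ℕ) i) * X i :=
  aeval_X _ i

/-- `σ₀` on monomials: `σ₀(c·uⁱvʲ) = ζ^{i + q j} · c·uⁱvʲ`. [folklore] -/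
theorem rootAut_monomial (ζ : k) (q : ℕ) (d : Fin 2 →₀ ℕ) (c : k) :
    aeval (fun i : Fin 2 => C (ζ ^ (![1, q] : Fin 2 → ℕ) i) * X i) (monomial d c) =
      C (ζ ^ (d 0 + q * d 1)) * monomial d c := by
  rw [aeval_monomial, Finsupp.prod_fintype _ _ (fun i => by simp), Fin.prod_univ_two]
  simp only [Matrix.cons_val_zero, Matrix.cons_val_one, pow_one, mul_pow, ← map_pow, ← pow_mul]
  rw [MvPolynomial.algebraMap_eq, monomial_eq, Finsupp.prod_fintype _ _ (fun i => by simp), Fin.prod_univ_two, pow_add,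
    C_mul]
  ring

/-- `σ₀` acts on a monomial TERM of any polynomial: coefficientwise `σ₀ p = Σ_d ζ^{wt d} p_d uᵈ`. Consequence:
`p` is fixed iff every monomial in its support has weight `≡ 0`, when `ζ` is a primitive `n`-th root. [folklore] -/
theorem rootAut_eq_self_iff {n : ℕ} [NeZero n] {ζ : k} (hζ : IsPrimitiveRoot ζ n) (q : ℕ)
    (p : MvPolynomial (Fin 2) k) :
    aeval (fun i : Fin 2 => C (ζ ^ (![1, q] : Fin 2 → ℕ) i) * X i) p = p ↔
      ∀ d ∈ p.support, (n : ℕ) ∣ d 0 + q * d 1 := by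
  set σ₀ := aeval (R := k) (fun i : Fin 2 => C (ζ ^ (![1, q] : Fin 2 → ℕ) i) * X i) with hσ₀
  have hcoeff : ∀ d, coeff d (σ₀ p) = ζ ^ (d 0 + q * d 1) * coeff d p := by
    intro d
    conv_lhs => rw [p.as_sum, map_sum]
    rw [coeff_sum]
    simp only [hσ₀, rootAut_monomial, coeff_C_mul, coeff_monomial]
    rw [Finset.sum_eq_single d (fun d' _ hne => by rw [if_neg hne, mul_zero]) (fun hd => by
      rw [if_pos rfl, notMem_support_iff.mp hd, mul_zero])]
    rw [if_pos rfl]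
  constructor
  · intro h d hd
    have hc := hcoeff d
    rw [h] at hc
    have hne : coeff d p ≠ 0 := mem_support_iff.mp hd
    have h1 : ζ ^ (d 0 + q * d 1) = 1 := by
      have : (ζ ^ (d 0 + q * d 1) - 1) * coeff d p = 0 := by rw [sub_mul, one_mul, ← hc, sub_self]
      exact sub_eq_zero.mp ((mul_eq_zero.mp this).resolve_right hne)
    exact (hζ.pow_eq_one_iff_dvd _).mp h1
  · intro h
    apply MvPolynomial.ext
    intro d
    rw [hcoeff]
    by_cases hd : d ∈ p.support
    · rw [(hζ.pow_eq_one_iff_dvd _).mpr (h d hd), one_mul]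
    · rw [notMem_support_iff.mp hd, mul_zero]

/-! ## The action data over the fixed ring `U` -/

section Action

variable {n : ℕ} [NeZero n] {ζ : k} (hζ : IsPrimitiveRoot ζ n) (q : ℕ)
variable (U : Subalgebra k (MvPolynomial (Fin 2) k))
variable (hU : ∀ p, p ∈ U ↔ aeval (fun i : Fin 2 => C (ζ ^ (![1, q] : Fin 2 → ℕ) i) * X i) p = p)

include hζ hU in
/-- **The action data.**  `σ : Multiplicative (ZMod n) →* (k[u,v] →ₐ[U] k[u,v])`, `σ (ofAdd a) = σ₀^{a.val}`,
with fixed ring exactly `U` (and `algebraMap U V` injective). [OURS · L1 w44b] -/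
theorem exists_action :
    ∃ σ : Multiplicative (ZMod n) →* (MvPolynomial (Fin 2) k →ₐ[U] MvPolynomial (Fin 2) k),
      (∀ (a : ZMod n) (p : MvPolynomial (Fin 2) k), σ (Multiplicative.ofAdd a) p =
        ((aeval (fun i : Fin 2 => C (ζ ^ (![1, q] : Fin 2 → ℕ) i) * X i) : _ →ₐ[k] _) ^ a.val) p) ∧
      (∀ v, (∀ g, σ g v = v) → ∃ u : U, algebraMap U (MvPolynomial (Fin 2) k) u = v) := by
  set σ₀ := aeval (R := k) (fun i : Fin 2 => C (ζ ^ (![1, q] : Fin 2 → ℕ) i) * X i) with hσ₀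
  -- `σ₀` as a `U`-algebra map
  let σU : MvPolynomial (Fin 2) k →ₐ[U] MvPolynomial (Fin 2) k :=
    { σ₀.toRingHom with
      commutes' := fun u => by
        change σ₀ (u : MvPolynomial (Fin 2) k) = u
        exact (hU u).mp u.2 }
  have hσU : ∀ p, σU p = σ₀ p := fun _ => rfl
  have hσUpow : ∀ m p, (σU ^ m) p = (σ₀ ^ m) p := by
    intro m; induction m with
    | zero => intro p; rfl
    | succ m ih => intro p; rw [pow_succ, pow_succ, AlgHom.mul_apply, AlgHom.mul_apply, hσU, ih]
  have hC : ∀ (φ : MvPolynomial (Fin 2) k →ₐ[k] MvPolynomial (Fin 2) k) (a : k), φ (C a) = C a :=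
    fun φ a => φ.commutes a
  -- `σ₀ⁿ = 1`
  have hσ₀n : σ₀ ^ n = 1 := by
    apply MvPolynomial.algHom_ext
    intro i
    rw [AlgHom.one_apply]
    have : ∀ m, (σ₀ ^ m) (X i) = C (ζ ^ ((![1, q] : Fin 2 → ℕ) i * m)) * X i := by
      intro m; induction m with
      | zero => simp
      | succ m ih =>
        rw [pow_succ, AlgHom.mul_apply, hσ₀, rootAut_X, ← hσ₀, map_mul, ih, hC]
        rw [← mul_assoc, ← C_mul, ← pow_add,
          show (![1, q] : Fin 2 → ℕ) i + (![1, q] : Fin 2 → ℕ) i * m = (![1, q] : Fin 2 → ℕ) i * (m + 1) by ring]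
    rw [this, show (![1, q] : Fin 2 → ℕ) i * n = n * (![1, q] : Fin 2 → ℕ) i from Nat.mul_comm _ _, pow_mul,
      hζ.pow_eq_one, one_pow, C_1, one_mul]
  have hσUn : σU ^ n = 1 := by
    apply AlgHom.ext; intro p; rw [hσUpow, hσ₀n]; rfl
  let σ : Multiplicative (ZMod n) →* (MvPolynomial (Fin 2) k →ₐ[U] MvPolynomial (Fin 2) k) :=
    { toFun := fun g => σU ^ (Multiplicative.toAdd g).val
      map_one' := by simp
      map_mul' := fun g h => by
        rw [toAdd_mul, ZMod.val_add, ← pow_add]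
        conv_rhs => rw [← Nat.mod_add_div ((Multiplicative.toAdd g).val + (Multiplicative.toAdd h).val) n]
        rw [pow_add, pow_mul, hσUn, one_pow, mul_one] }
  refine ⟨σ, fun a p => hσUpow _ _, fun v hv => ?_⟩
  -- fixed vectors lie in `U`: use `g = ofAdd 1` (and `σ₀ⁿ = 1` when `n = 1`)
  have h1 : (σ₀ ^ (1 : ZMod n).val) v = v := by rw [← hσUpow]; exact hv (Multiplicative.ofAdd 1)
  have hfix : σ₀ v = v := by
    rcases Nat.lt_or_ge 1 n with hn | hn
    · haveI : Fact (1 < n) := ⟨hn⟩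
      rwa [ZMod.val_one, pow_one] at h1
    · have hn1 : n = 1 := le_antisymm hn (NeZero.one_le)
      have := hσ₀n; rw [hn1, pow_one] at this; rw [this]; rfl
  exact ⟨⟨v, (hU v).mpr hfix⟩, rfl⟩

end Action

/-! ## (BIG) for `k[u,v]`: height-one primes miss a pure power of `u` or of `v` -/

/-- A height-one prime of `k[u,v]` cannot contain both `u` and `v` (`⊥ < (u) < P` would give height `≥ 2`).
[folklore] -/
theorem not_X_mem_and_X_mem {P : Ideal (MvPolynomial (Fin 2) k)} (hP : P.IsPrime) (hP1 : P.height = 1) :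
    ¬ ((X 0 : MvPolynomial (Fin 2) k) ∈ P ∧ (X 1 : MvPolynomial (Fin 2) k) ∈ P) := by
  rintro ⟨h0, h1⟩
  have hX0 : Prime (X 0 : MvPolynomial (Fin 2) k) := X_prime
  haveI hQ : (Ideal.span {(X 0 : MvPolynomial (Fin 2) k)}).IsPrime :=
    (Ideal.span_singleton_prime hX0.ne_zero).mpr hX0
  have hbot : (⊥ : Ideal (MvPolynomial (Fin 2) k)) < Ideal.span {X 0} :=
    bot_lt_iff_ne_bot.mpr (by rw [Ne, Ideal.span_singleton_eq_bot]; exact hX0.ne_zero)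
  have hle : Ideal.span {(X 0 : MvPolynomial (Fin 2) k)} ≤ P := (Ideal.span_singleton_le_iff_mem _).mpr h0
  have hne : Ideal.span {(X 0 : MvPolynomial (Fin 2) k)} ≠ P := by
    intro h
    have : (X 1 : MvPolynomial (Fin 2) k) ∈ Ideal.span {(X 0 : MvPolynomial (Fin 2) k)} := h ▸ h1
    rw [Ideal.mem_span_singleton, X_dvd_X] at this
    exact absurd this (by decide)
  have hlt : Ideal.span {(X 0 : MvPolynomial (Fin 2) k)} < P := lt_of_le_of_ne hle hne
  have e1 := Ideal.height_add_one_le_of_lt_of_isPrime hbot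
  have e2 := Ideal.height_add_one_le_of_lt_of_isPrime hlt
  rw [Ideal.height_bot, zero_add] at e1
  rw [hP1] at e2
  have e3 : (1 : ℕ∞) + 1 ≤ (Ideal.span {(X 0 : MvPolynomial (Fin 2) k)}).height + 1 := add_le_add e1 le_rfl
  exact absurd (e3.trans e2) (by decide)

/-! ## The instantiated law -/

section Law

variable {n : ℕ} [NeZero n] {ζ : k} (hζ : IsPrimitiveRoot ζ n) (hn : (n : k) ≠ 0) {q : ℕ} (hq : q.Coprime n)
variable (U : Subalgebra k (MvPolynomial (Fin 2) k))
variable (hU : ∀ p, p ∈ U ↔ aeval (fun i : Fin 2 => C (ζ ^ (![1, q] : Fin 2 → ℕ) i) * X i) p = p)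

/-- Powers of a root of unity only depend on the exponent mod `n`. [folklore] -/
theorem pow_eq_pow_of_modEq {M : Type*} [Monoid M] {ζ : M} {n : ℕ} (hζn : ζ ^ n = 1) {a b : ℕ} (h : a ≡ b [MOD n]) :
    ζ ^ a = ζ ^ b := by
  rw [← Nat.mod_add_div a n, ← Nat.mod_add_div b n, pow_add, pow_add, pow_mul, pow_mul, hζn, one_pow, one_pow,
    mul_one, mul_one, h]

include hζ hn hq hU in
/-- **AUSLANDER'S LAW for the cyclic quotient surface `U = k[u,v]^{μ_n(1,q)}` at level `ca³`.**  For `x ∈ U`: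
`x ∈ ca³(U)` iff for every residue `a` mod `n`, `x = Σ_k b_k b′_k` in `k[u,v]` with `σ₀ b_k = ζ^{a} b_k` and
`σ₀ b′_k = ζ^{-a} b′_k` (i.e. `x ∈ ⋂_a V_[a]·V_[−a] = ⋂_a τ(M_a)`).  Hypotheses discharged here: fixed ring,
characters/orthogonality (`ζ` primitive, `n ∈ kˣ`), (BIG) (`gcd(q,n) = 1`), normality of `k[u,v]`, `ca³(k[u,v]) = ⊤`;
remaining instance hypotheses: `U` noetherian, `k[u,v]` module-finite over `U`. [OURS · L1 w44b] -/
theorem mem_cohomologyAnnihilatorOfDegree_three_iff_cyclicQuotient [IsNoetherianRing U]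
    [Module.Finite U (MvPolynomial (Fin 2) k)] (x : U) :
    x ∈ cohomologyAnnihilatorOfDegree U 3 ↔
      ∀ a : ZMod n, ∃ (m : ℕ) (b b' : Fin m → MvPolynomial (Fin 2) k),
        (∀ j, aeval (fun i : Fin 2 => C (ζ ^ (![1, q] : Fin 2 → ℕ) i) * X i) (b j) = C (ζ ^ a.val) * b j) ∧
        (∀ j, aeval (fun i : Fin 2 => C (ζ ^ (![1, q] : Fin 2 → ℕ) i) * X i) (b' j) = C (ζ ^ (-a).val) * b' j) ∧
        ∑ j, b j * b' j = (x : MvPolynomial (Fin 2) k) := by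
  classical
  set V := MvPolynomial (Fin 2) k
  set σ₀ := aeval (R := k) (fun i : Fin 2 => C (ζ ^ (![1, q] : Fin 2 → ℕ) i) * X i) with hσ₀
  obtain ⟨σ, hσ, hfix⟩ := exists_action hζ q U hU
  have hinj : Function.Injective (algebraMap U V) := Subtype.val_injective
  -- the bicharacter `χ x g = ζ^{x g}` (computed in `k`, transported to `U`)
  have hζn : ζ ^ n = 1 := hζ.pow_eq_one
  let χ : Multiplicative (ZMod n) → Multiplicative (ZMod n) → U :=
    fun x g => algebraMap k U (ζ ^ ((Multiplicative.toAdd x).val * (Multiplicative.toAdd g).val))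
  have hχval : ∀ x g, algebraMap U V (χ x g) =
      C (ζ ^ ((Multiplicative.toAdd x).val * (Multiplicative.toAdd g).val)) := fun x g => rfl
  have hχmod : ∀ {a b : ℕ}, a ≡ b [MOD n] → ζ ^ a = ζ ^ b := fun h => pow_eq_pow_of_modEq hζn h
  have hχone₁ : ∀ g, χ 1 g = 1 := fun g => by simp [χ]
  have hχone₂ : ∀ x, χ x 1 = 1 := fun x => by simp [χ]
  have hχmul₁ : ∀ x x' g, χ (x * x') g = χ x g * χ x' g := fun x x' g => by
    simp only [χ, toAdd_mul, ← map_mul, ← pow_add, ← add_mul]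
    congr 1; apply hχmod
    rw [ZMod.val_add]
    exact (Nat.mod_modEq _ _).mul_right _
  have hχmul₂ : ∀ x g h, χ x (g * h) = χ x g * χ x h := fun x g h => by
    simp only [χ, toAdd_mul, ← map_mul, ← pow_add, ← mul_add]
    congr 1; apply hχmod
    rw [ZMod.val_add]
    exact (Nat.mod_modEq _ _).mul_left _
  have horth : ∀ g : Multiplicative (ZMod n), g ≠ 1 → ∑ x, χ x g = 0 := fun g hg => by
    simp only [χ, ← map_sum]
    rw [sum_pow_val_mul_val_eq_zero (sum_pow_mul_eq_zero_of_isPrimitiveRoot hζ) g hg, map_zero]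
  have hGU : IsUnit ((Fintype.card (Multiplicative (ZMod n)) : ℕ) : U) := by
    rw [Fintype.card_multiplicative, ZMod.card]
    have : ((n : ℕ) : U) = algebraMap k U n := by rw [map_natCast]
    rw [this]
    exact (IsUnit.mk0 _ hn).map _
  have hCm : ∀ (m : ℕ) (a : k), (σ₀ ^ m) (C a) = C a := fun m a => (σ₀ ^ m).commutes a
  -- characters of monomials under `σ`
  have hσmon : ∀ (g : Multiplicative (ZMod n)) (d : Fin 2 →₀ ℕ) (c : k),
      σ g (monomial d c) = C (ζ ^ ((d 0 + q * d 1) * (Multiplicative.toAdd g).val)) * monomial d c := by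
    intro g d c
    rw [show g = Multiplicative.ofAdd (Multiplicative.toAdd g) from rfl, hσ, toAdd_ofAdd]
    generalize (Multiplicative.toAdd g).val = m
    induction m with
    | zero => simp
    | succ m ih =>
      rw [pow_succ, AlgHom.mul_apply, ← hσ₀, rootAut_monomial, map_mul, ih, hCm, ← mul_assoc, ← C_mul, ← pow_add,
        show d 0 + q * d 1 + (d 0 + q * d 1) * m = (d 0 + q * d 1) * (m + 1) by ring]
  -- (BIG)
  have hbig : ∀ (x : Multiplicative (ZMod n)) (P : Ideal V), P.IsPrime → P.height = 1 →
      ∃ m : V, (∀ g, σ g m = algebraMap U V (χ x g) * m) ∧ m ∉ P := by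
    intro x P hP hP1
    set t := (Multiplicative.toAdd x).val
    -- the exponent `s` with `q s ≡ t (mod n)`
    let qu : (ZMod n)ˣ := ZMod.unitOfCoprime q hq
    set s := ((qu⁻¹ : (ZMod n)ˣ) * Multiplicative.toAdd x : ZMod n).val with hs
    have hqs : q * s ≡ t [MOD n] := by
      rw [← ZMod.natCast_eq_natCast_iff, Nat.cast_mul, hs, ZMod.natCast_val, ZMod.cast_id', id, ← mul_assoc,
        show ((q : ℕ) : ZMod n) = (qu : ZMod n) from (ZMod.coe_unitOfCoprime q hq).symm, Units.mul_inv, one_mul,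
        ZMod.natCast_val, ZMod.cast_id', id]
    have hu : ∀ g, σ g (X 0 ^ t) = algebraMap U V (χ x g) * X 0 ^ t := fun g => by
      rw [hχval, show (X 0 ^ t : V) = monomial (Finsupp.single 0 t) 1 by rw [X_pow_eq_monomial], hσmon]
      simp [t]
    have hv : ∀ g, σ g (X 1 ^ s) = algebraMap U V (χ x g) * X 1 ^ s := fun g => by
      rw [hχval, show (X 1 ^ s : V) = monomial (Finsupp.single 1 s) 1 by rw [X_pow_eq_monomial], hσmon]
      simp only [Finsupp.single_apply, Fin.one_eq_zero_iff, OfNat.ofNat_ne_one, if_false, zero_add, if_true]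
      rw [pow_eq_pow_of_modEq hζn (hqs.mul_right _)]
    by_contra hcon
    push Not at hcon
    have h0 : (X 0 : V) ^ t ∈ P := hcon _ hu
    have h1 : (X 1 : V) ^ s ∈ P := hcon _ hv
    exact not_X_mem_and_X_mem hP hP1 ⟨hP.mem_of_pow_mem _ h0, hP.mem_of_pow_mem _ h1⟩
  -- nonvanishing of every isotypic piece: `u^t`
  have hne : ∀ x : Multiplicative (ZMod n), ∃ m : V, (∀ g, σ g m = algebraMap U V (χ x g) * m) ∧ m ≠ 0 := by
    intro x
    refine ⟨X 0 ^ (Multiplicative.toAdd x).val, fun g => ?_, pow_ne_zero _ (X_ne_zero 0)⟩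
    rw [hχval, show (X 0 ^ (Multiplicative.toAdd x).val : V) = monomial (Finsupp.single 0 _) 1 by
      rw [X_pow_eq_monomial], hσmon]
    simp
  have hV : cohomologyAnnihilatorOfDegree V 3 = ⊤ := cohomologyAnnihilatorOfDegree_mvPolynomial_eq_top k 2
  -- the abstract law
  have key := mem_cohomologyAnnihilatorOfDegree_three_iff_of_eq_top σ hfix hinj χ hχone₁ hχmul₁ hχone₂ hχmul₂
    horth hGU hbig hV hne x
  rw [key]
  -- translate characters `χ (ofAdd a)^{±1}` into `ζ`-powers
  have htrans : ∀ (a : ZMod n) (b : V),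
      ((∀ g, σ g b = algebraMap U V (χ (Multiplicative.ofAdd a) g) * b) ↔ σ₀ b = C (ζ ^ a.val) * b) := by
    intro a b
    constructor
    · intro h
      have := h (Multiplicative.ofAdd 1)
      rw [hσ, hχval, toAdd_ofAdd, toAdd_ofAdd] at this
      rcases Nat.lt_or_ge 1 n with h1 | h1
      · haveI hfact : Fact (1 < n) := ⟨h1⟩
        rw [ZMod.val_one, pow_one, mul_one] at this
        rw [hσ₀]; exact this
      · have hn1 : n = 1 := le_antisymm h1 (NeZero.one_le)
        subst hn1
        have hz : ζ = 1 := by simpa using hζn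
        have hid : σ₀ = AlgHom.id k V := by
          apply MvPolynomial.algHom_ext; intro i; rw [hσ₀, rootAut_X, hz, one_pow, C_1, one_mul]; rfl
        rw [hid, AlgHom.id_apply, hz, one_pow, C_1, one_mul]
    · intro h g
      rw [hχval, toAdd_ofAdd, show g = Multiplicative.ofAdd (Multiplicative.toAdd g) from rfl, hσ, toAdd_ofAdd]
      generalize (Multiplicative.toAdd g).val = m
      induction m with
      | zero => simp
      | succ m ih =>
        rw [pow_succ, AlgHom.mul_apply, ← hσ₀, h, map_mul, hσ₀, ih, ← hσ₀, hCm, ← mul_assoc, ← C_mul, ← pow_add,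
          show a.val + a.val * m = a.val * (m + 1) by ring]
  have hinv : ∀ a : ZMod n, (Multiplicative.ofAdd a)⁻¹ = Multiplicative.ofAdd (-a) := fun a => rfl
  constructor
  · intro h a
    obtain ⟨m, b, b', hb, hb', hsum⟩ := h (Multiplicative.ofAdd a)
    refine ⟨m, b, b', fun j => (htrans a (b j)).mp (hb j), fun j => (htrans (-a) (b' j)).mp ?_, hsum⟩
    rw [← hinv]; exact hb' j
  · intro h xg
    obtain ⟨m, b, b', hb, hb', hsum⟩ := h (Multiplicative.toAdd xg)
    refine ⟨m, b, b', fun j => (htrans _ (b j)).mpr (hb j), fun j => ?_, hsum⟩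
    have := (htrans (-(Multiplicative.toAdd xg)) (b' j)).mpr (hb' j)
    rw [← hinv] at this; exact this

include hζ hn hq hU in
/-- **The engines' criterion at a cyclic arrival** (`kstar.cyclic_ca_contains`, `cycca.py`): an invariant monomial
`uⁱvʲ ∈ U` admitting, for every residue `a` mod `n`, a divisor `u^{i₁}v^{j₁}` (`i₁ ≤ i`, `j₁ ≤ j`) of weight
`i₁ + q j₁ ≡ a`, lies in `ca³(U)` (hence in `ca(U)`). [OURS · L1 w44b] -/
theorem monomial_mem_cohomologyAnnihilatorOfDegree_three [IsNoetherianRing U]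
    [Module.Finite U (MvPolynomial (Fin 2) k)] (i j : ℕ) (hmem : (X 0 ^ i * X 1 ^ j : MvPolynomial (Fin 2) k) ∈ U)
    (hdiv : ∀ a : ZMod n, ∃ i₁ j₁ : ℕ, i₁ ≤ i ∧ j₁ ≤ j ∧ ((i₁ + q * j₁ : ℕ) : ZMod n) = a) :
    (⟨X 0 ^ i * X 1 ^ j, hmem⟩ : U) ∈ cohomologyAnnihilatorOfDegree U 3 := by
  classical
  have hζn : ζ ^ n = 1 := hζ.pow_eq_one
  have hij : (n : ℕ) ∣ i + q * j := by
    have h := (rootAut_eq_self_iff hζ q _).mp ((hU _).mp hmem)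
    have hsupp : (Finsupp.single 0 i + Finsupp.single 1 j : Fin 2 →₀ ℕ) ∈ (X 0 ^ i * X 1 ^ j : MvPolynomial (Fin 2) k).support := by
      rw [X_pow_eq_monomial, X_pow_eq_monomial, monomial_mul, mul_one, support_monomial, if_neg one_ne_zero]
      exact Finset.mem_singleton_self _
    simpa [Finsupp.single_apply] using h _ hsupp
  rw [mem_cohomologyAnnihilatorOfDegree_three_iff_cyclicQuotient hζ hn hq U hU]
  intro a
  obtain ⟨i₁, j₁, hi, hj, ha⟩ := hdiv a
  have hmon : ∀ i' j' : ℕ, aeval (fun l : Fin 2 => C (ζ ^ (![1, q] : Fin 2 → ℕ) l) * X l) (X 0 ^ i' * X 1 ^ j' : MvPolynomial (Fin 2) k)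
      = C (ζ ^ (i' + q * j')) * (X 0 ^ i' * X 1 ^ j') := by
    intro i' j'
    rw [show (X 0 ^ i' * X 1 ^ j' : MvPolynomial (Fin 2) k) = monomial (Finsupp.single 0 i' + Finsupp.single 1 j') 1 by
      rw [X_pow_eq_monomial, X_pow_eq_monomial, monomial_mul, mul_one], rootAut_monomial]
    simp
  refine ⟨1, fun _ => X 0 ^ i₁ * X 1 ^ j₁, fun _ => X 0 ^ (i - i₁) * X 1 ^ (j - j₁), fun _ => ?_, fun _ => ?_, ?_⟩
  · rw [hmon, pow_eq_pow_of_modEq hζn]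
    rw [← ZMod.natCast_eq_natCast_iff, ha, ZMod.natCast_val, ZMod.cast_id', id]
  · rw [hmon, pow_eq_pow_of_modEq hζn]
    rw [← ZMod.natCast_eq_natCast_iff, ZMod.natCast_val, ZMod.cast_id', id, eq_neg_iff_add_eq_zero, ← ha,
      ← Nat.cast_add, show i - i₁ + q * (j - j₁) + (i₁ + q * j₁) = i + q * j by
        zify [hi, hj]; ring, ZMod.natCast_eq_zero_iff]
    exact hij
  · rw [Fin.sum_univ_one]
    change X 0 ^ i₁ * X 1 ^ j₁ * (X 0 ^ (i - i₁) * X 1 ^ (j - j₁)) = X 0 ^ i * X 1 ^ j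
    rw [mul_mul_mul_comm, ← pow_add, ← pow_add, Nat.add_sub_cancel' hi, Nat.add_sub_cancel' hj]

end Law

end Summit.ResolutionOfSingularities.ResolutionOfSingularities.Theorems.HomologicalConductor.PersistenceCyclicQuotientSurface

end
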